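import Summits.BirchSwinnertonDyer.Rank1Residual.X11b.RingClassUnitIdele
import Literature.NumberTheory.Automorphic.ArtinLFunctionsAbelianConductorProofs
import Literature.NumberTheory.GaloisRepresentations.HeckeCharacterWeakApproximation
import Literature.NumberTheory.GaloisRepresentations.GlobalArtinMapOfCharactersProofs
import Literature.NumberTheory.GaloisRepresentations.ArtinCharacterLocalGlobalProofs
import Literature.NumberTheory.GaloisRepresentations.IntegralGaloisActionProofs
import Literature.NumberTheory.QuadraticFields.RingClassNumber
import HarnessLib

/-!
# Conductor descent for ring class characters, class-field form: a character of `Gal(E/K)` with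
# Frobenius values `χ([·]_m)` that kills one inertia group above `λ ∥ m` dies on conductor `m/ℓ`

Cell `b2b-bsdres`, team x11b3 (N8/O2), lead ruling R8-42 (A) = sub-target (b2) of the `htot`
programme (total ramification of `λ = (ℓ)` in the ring class tower `K[m]/K[m/ℓ]`, Gross 1991 p. 218
l. 1 / McCallum 1991 p. 282 l. 1; consumer: x11b3-p8's duality/Bauer file).  Sequel of
`RingClassUnitIdele` (the Hecke form (E1)).  HONEST FRAMING (cell, verbatim): published theorems
only; nothing booked; class-field-theory hygiene for the Kolyvagin chain, nothing `p = 3`-specific,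
JET@p∣N untouched, `h44` NOT discharged here; O2 OPEN / N8 CONSTRUCTION.  Theorems only — no
definition, no named fact.

* `ringClassChar_factors_of_isUnramifiedAt` (E2) — `K` imaginary quadratic, `m ≠ 0`, `ℓ` prime,
  `ℓ ∣ m`, `ℓ ∤ m/ℓ`, `v₀` the unique prime above `ℓ`, `χ` a character of `I_K(m)/P_{K,ℤ}(m)`,
  `E ⊆ K̄` finite Galois over `K` unramified off `m`, `θ` a character of `Gal(E/K)` whose value at
  (the restriction of) every arithmetic Frobenius above `v ∤ m` is `χ([𝔭_v]_m)` — the shape OUTPUT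
  by the tree's `exists_classField_character_of_isRayClassCharacter` — and which kills the inertia
  group `I_{𝔓₀} ≤ Γ_K` of ONE prime `𝔓₀ ∣ v₀`.  Then `χ([𝔭_v]_m) = 1` for every `v ∤ m` with
  `[𝔭_v]_{m/ℓ} = 1`.

Proof.  The inflated rank-one Artin representation `ρ = θ ∘ r_E` is unramified off `m`
(`inflateCharacter_isUnramifiedAt`) and at `v₀` (inertia groups above `v₀` are `Γ_K`-conjugate,
`exists_smul_eq_of_mem_primesAbove_holds`).  By **Artin reciprocity in primitive form**
(`Automorphic.artinReciprocity_character_primitive_holds`, PROVED in the tree: Neukirch VII (10.6)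
with VI (6.6), the conductor–ramification clause proved analytically) there is a finite-order Hecke
character `ω'` unramified EXACTLY where `ρ` is, with `ω'(ϖ_v) = det ρ(Φ_v) = χ([𝔭_v]_m)` off `m`;
by **rigidity** (`HeckeCharacter.ext_of_eventually_valueAtUniformizer_eq`) `ω'` is the Hecke character
`ω = heckeOfRayClass` of the ray class character `𝔭 ↦ χ([𝔭]_m) mod m𝓞_K`
(`heckeOfRayClass_valueAtUniformizer`), so `ω` is unramified at `v₀`, and (E1)
`RingClassTower.ringClassChar_eq_one_of_heckeUnramified` concludes.

## References
* [NeukirchANT1999] J. Neukirch, *Algebraic Number Theory* (1999), Ch. VI §6 Cor. (6.6), §7 (7.1);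
  Ch. VII §10 Thm. (10.6) and Remark.
* [Cox2013] D. A. Cox, *Primes of the form x² + ny²*, 2nd ed. (2013), §7.C Prop. 7.22, §9.A.
* [GrossLMS1991] B. H. Gross, *Kolyvagin's work on modular elliptic curves*, §3 p. 218 l. 1.

## Mathlib / tree search
Tree: `Automorphic.artinReciprocity_character_primitive_holds`, `inflateCharacter(_apply_coe/_isUnramifiedAt/
_apply_eq_one_iff)`, `HeckeCharacter.ext_of_eventually_valueAtUniformizer_eq`, `heckeOfRayClass_valueAtUniformizer`,
`RingClassField.isRayClassCharacter_primeClass`, `RingClass.finite_ringClassGroup`,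
`exists_smul_eq_of_mem_primesAbove_holds`, `exists_isArithFrobAt_of_mem_primesAbove_holds`, `primesAbove_nonempty`,
`FramedRep.det_apply`, `Matrix.det_fin_one`.  `lean search 'factors_of_isUnramifiedAt|conductor descent'`: nothing prior.
-/

noncomputable section

open scoped Classical nonZeroDivisors Pointwise
open NumberField IsDedekindDomain IsDedekindDomain.HeightOneSpectrum Filter Field
open Literature.NumberTheory.GaloisRepresentations Literature.NumberTheory.LFunctions
open Literature.NumberTheory.NumberFields Literature.NumberTheory.NumberFields.RingClassField
open Literature.NumberTheory.QuadraticFields.RingClass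
open Literature.NumberTheory.EllipticCurves (IsImaginaryQuadratic)

namespace Summit.BirchSwinnertonDyer.Rank1Residual.X11b.RingClassTower

variable {K : Type} [Field K] [NumberField K]

/-- A character of `Γ_K` with commutative values that kills the inertia group of ONE prime `𝔓₀ ∣ v`
kills the inertia group of every prime above `v` (`I_{τ • 𝔓₀} = τ I_{𝔓₀} τ⁻¹` and `Γ_K` is
transitive on the primes above `v`, `exists_smul_eq_of_mem_primesAbove_holds`; Serre, *Abelian
ℓ-adic representations*, I §2.1; Neukirch I (9.1)). [cite: NeukirchANT1999, Ch. I §9 Prop. (9.1)] -/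
theorem forall_inertia_eq_one_of_one_prime {C : Type*} [CommGroup C]
    (φ : absoluteGaloisGroup K →* C) {v : HeightOneSpectrum (𝓞 K)}
    {𝔓₀ : Ideal (absIntegers (𝓞 K) K)} (h𝔓₀ : 𝔓₀ ∈ v.primesAbove)
    (h : ∀ τ ∈ 𝔓₀.inertia (absoluteGaloisGroup K), φ τ = 1)
    {𝔓 : Ideal (absIntegers (𝓞 K) K)} (h𝔓 : 𝔓 ∈ v.primesAbove)
    {σ : absoluteGaloisGroup K} (hσ : σ ∈ 𝔓.inertia (absoluteGaloisGroup K)) : φ σ = 1 := by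
  obtain ⟨τ, rfl⟩ := exists_smul_eq_of_mem_primesAbove_holds h𝔓₀ h𝔓
  have hσ' : τ⁻¹ * σ * τ ∈ 𝔓₀.inertia (absoluteGaloisGroup K) := by
    intro x
    have hx : σ • τ • x - τ • x ∈ τ • 𝔓₀ := hσ (τ • x)
    rw [Ideal.mem_pointwise_smul_iff_inv_smul_mem, smul_sub] at hx
    simpa [mul_smul] using hx
  have h1 := h _ hσ'
  have e : σ = τ * (τ⁻¹ * σ * τ) * τ⁻¹ := by group
  rw [e, map_mul, map_mul, h1, mul_one, ← map_mul, mul_inv_cancel, map_one]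

/-- **(E2) Conductor descent for ring class characters, class-field form** (the END statement of
R8-42 (A)).  Let `K` be imaginary quadratic, `m ≠ 0`, `ℓ` a prime with `ℓ ∣ m`, `ℓ ∤ m/ℓ`, `v₀` the
unique prime of `K` above `ℓ`, `χ` a character of `I_K(m)/P_{K,ℤ}(m)`; let `E ⊆ K̄` be finite Galois
over `K`, unramified at every `v ∤ m`, and `θ` a character of `Gal(E/K)` whose value at every
arithmetic Frobenius above `v ∤ m` is `χ([𝔭_v]_m)` and which kills the inertia group at one prime
`𝔓₀ ∣ v₀` of `\bar ℤ_K`.  Then `χ([𝔭_v]_m) = 1` for every `v ∤ m` of trivial class of conductor `m/ℓ`: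
the class field of `χ` being unramified at `λ`, the modulus of `χ` drops `λ` — Neukirch VI (6.6)
"`𝔭` is ramified in `L ⟺ 𝔭 ∣ 𝔣`" for the ring class characters, via Artin reciprocity in primitive
form (`artinReciprocity_character_primitive_holds`), rigidity of Hecke characters and (E1).
[cite: NeukirchANT1999, Ch. VI §6 Cor. (6.6) and Ch. VII §10 Thm. (10.6)] [cite: Cox2013, §9.A] -/
theorem ringClassChar_factors_of_isUnramifiedAt (hK : IsImaginaryQuadratic K)
    {m ℓ : ℕ} (hm : m ≠ 0) (hℓ : ℓ.Prime) (hℓm : ℓ ∣ m) (hℓm' : ¬ ℓ ∣ m / ℓ)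
    {v₀ : HeightOneSpectrum (𝓞 K)}
    (hv₀ : ∀ v : HeightOneSpectrum (𝓞 K), ((ℓ : ℕ) : 𝓞 K) ∈ v.asIdeal ↔ v = v₀)
    (χ : RingClassGroup K m →* ℂˣ)
    (E : IntermediateField K (AlgebraicClosure K)) [FiniteDimensional K E] [IsGalois K E]
    (θ : (E ≃ₐ[K] E) →* ℂˣ)
    (hE : ∀ v : HeightOneSpectrum (𝓞 K), ((m : ℕ) : 𝓞 K) ∉ v.asIdeal →
      Algebra.IsUnramifiedIn (𝓞 E) v.asIdeal)
    (hθ : ∀ v : HeightOneSpectrum (𝓞 K), ((m : ℕ) : 𝓞 K) ∉ v.asIdeal → ∀ 𝔓 ∈ v.primesAbove,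
      ∀ σ : absoluteGaloisGroup K, IsArithFrobAt (𝓞 K) σ 𝔓 →
        ((θ (absRestrictNormalHom E σ) : ℂˣ) : ℂ) = χ (primeClass m v))
    {𝔓₀ : Ideal (absIntegers (𝓞 K) K)} (h𝔓₀ : 𝔓₀ ∈ v₀.primesAbove)
    (hθI : ∀ τ ∈ 𝔓₀.inertia (absoluteGaloisGroup K), θ (absRestrictNormalHom E τ) = 1)
    {v : HeightOneSpectrum (𝓞 K)} (hv : ((m : ℕ) : 𝓞 K) ∉ v.asIdeal) (h1 : primeClass (m / ℓ) v = 1) :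
    χ (primeClass m v) = 1 := by
  haveI : NumberField E := NumberField.of_module_finite K E
  haveI : Finite (RingClassGroup K m) := finite_ringClassGroup hK.1 hm
  -- the ray class character `ψ = χ([·]_m) mod (m)` and its Hecke character `ω`
  have h𝔣 : Ideal.span {((m : ℕ) : 𝓞 K)} ≠ ⊥ := by
    rw [Ne, Ideal.span_singleton_eq_bot]; exact_mod_cast hm
  have hψ : IsRayClassCharacter (Ideal.span {((m : ℕ) : 𝓞 K)}) (fun v => (χ (primeClass m v) : ℂ)) :=
    isRayClassCharacter_primeClass m χ
  have hle : ∀ w : HeightOneSpectrum (𝓞 K), Ideal.span {((m : ℕ) : 𝓞 K)} ≤ w.asIdeal ↔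
      ((m : ℕ) : 𝓞 K) ∈ w.asIdeal := fun w => Ideal.span_singleton_le_iff_mem _
  -- the inflated Artin character `ρ = θ ∘ r_E`
  set ρ : FramedArtinRep K 1 := inflateCharacter E θ with hρ
  have hρunr : ∀ w : HeightOneSpectrum (𝓞 K), ((m : ℕ) : 𝓞 K) ∉ w.asIdeal → ρ.IsUnramifiedAt w :=
    fun w hw => inflateCharacter_isUnramifiedAt E θ (hE w hw)
  have hρv₀ : ρ.IsUnramifiedAt v₀ := by
    intro 𝔓 h𝔓 σ hσ
    rw [hρ, inflateCharacter_apply]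
    exact (MulEquiv.map_eq_one_iff _).mpr
      (forall_inertia_eq_one_of_one_prime (θ.comp (absRestrictNormalHom E)) h𝔓₀ hθI h𝔓 hσ)
  -- Artin reciprocity, primitive form: the Hecke character `ω'` of `ρ`
  obtain ⟨ω', -, hω'⟩ := Literature.NumberTheory.Automorphic.artinReciprocity_character_primitive_holds
    (K := K) ρ
  -- `ω'` and `ω` agree at the uniformizers off `m`
  have hfin : {w : HeightOneSpectrum (𝓞 K) | ((m : ℕ) : 𝓞 K) ∈ w.asIdeal}.Finite := by
    refine (Ideal.finite_factors h𝔣).subset fun w hw => ?_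
    exact Ideal.dvd_iff_le.mpr ((hle w).mpr hw)
  have hagree : ∀ᶠ w in cofinite,
      (heckeOfRayClass h𝔣 hψ).valueAtUniformizer w = ω'.valueAtUniformizer w := by
    refine Filter.eventually_of_mem hfin.compl_mem_cofinite fun w hw => ?_
    have hw : ((m : ℕ) : 𝓞 K) ∉ w.asIdeal := hw
    rw [heckeOfRayClass_valueAtUniformizer h𝔣 hψ (fun h => hw ((hle w).mp h))]
    obtain ⟨𝔓, h𝔓⟩ := primesAbove_nonempty (K := K) w
    obtain ⟨Φ, hΦ⟩ := exists_isArithFrobAt_of_mem_primesAbove_holds h𝔓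
    rw [(hω' w).2 (hρunr w hw) 𝔓 h𝔓 Φ hΦ, FramedRep.det_apply, Matrix.GeneralLinearGroup.val_det_apply,
      Matrix.det_fin_one, hρ, inflateCharacter_apply_coe]
    exact (hθ w hw 𝔓 h𝔓 Φ hΦ).symm
  have hωω' : heckeOfRayClass h𝔣 hψ = ω' := HeckeCharacter.ext_of_eventually_valueAtUniformizer_eq hagree
  -- so `ω` is unramified at `v₀`, and (E1) applies
  have hunr : (heckeOfRayClass h𝔣 hψ).IsUnramifiedAt v₀ := by
    rw [hωω']; exact (hω' v₀).1.mpr hρv₀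
  exact ringClassChar_eq_one_of_heckeUnramified hK hm hℓ hℓm hℓm' hv₀ χ h𝔣 hψ hunr hv h1

end Summit.BirchSwinnertonDyer.Rank1Residual.X11b.RingClassTower

end
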